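import Literature.Probability.LatticeModels.PlaneRotatorStiffnessBoxCriterion
import Literature.Probability.LatticeModels.LayeredPlaneRotatorBoxDecoupling
import Literature.Probability.LatticeModels.PlaneRotatorOnsagerWindow
import HarnessLib

/-!
# The infinite-volume two-point function of the plane rotator and the Simon–Lieb dichotomy:
# `χ(K) < ∞ ⇔ S_R(K) < 1 for some R ⇒ βΥ_L(K) → 0`, and `Υ_L(K) ↛ 0 ⇒ χ(K) = ∞`

Topic `Literature/Probability/LatticeModels`. For the nearest-neighbour plane rotator on `ℤ^ν` at coupling
`K = βJ ≥ 0` (free boundary conditions: `twoPoint (nnXYCoupling K ν Λ)` of `PlaneRotatorGinibreComparison.lean` /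
`PlaneRotatorMeanFieldBound.lean` on a finite `Λ ⊂ ℤ^ν`) the finite-volume two-point functions
`⟨cos(θ_x − θ_y)⟩_{Λ,K}` increase with the volume (Griffiths–Ginibre, J. Ginibre, Comm. Math. Phys. **16** (1970)
310 [Ginibre1970]); their limit along the boxes `[−n,n]^ν` is the **infinite-volume (free-state) two-point function**
`G_K(x, y) = sup_n ⟨cos(θ_x − θ_y)⟩_{[−n,n]^ν, K}` (`infTwoPoint`), which dominates every finite volume. With it the two
halves of the tree's finite algorithm — Lieb's box criterion `⟨cos(θ_a − θ_c)⟩_Λ ≤ S_R(K)^{⌊‖a−c‖_∞/R⌋}`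
(`twoPoint_nn_le_pow_boxShellSum`, E. H. Lieb, Comm. Math. Phys. **77** (1980) 127 [Lieb1980], p. 128) and Simon's
form of the box number `S_R(K) ≤ ∑_{‖b‖_∞ = R} ⟨cos(θ_0 − θ_b)⟩_Λ` (`nnBoxShellSum_le_sum_shell_twoPoint`,
B. Simon, Comm. Math. Phys. **77** (1980) 111 [Simon1980CMP], Thm 1.3 / Lieb–Rivasseau for rotators) — become the
infinite-volume **Simon–Lieb dichotomy**, and the helicity-modulus criterion of
`PlaneRotatorStiffnessBoxCriterion.lean` reads as a statement about the susceptibility. All PROVED: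

* `volTwoPoint`, `infTwoPoint` — the finite-volume two-point function between lattice sites (`0` outside `Λ`) and
  its infinite-volume limit; `volTwoPoint_mono` (Griffiths–Ginibre in the volume), `volTwoPoint_le_infTwoPoint`
  (every finite volume is dominated), `tendsto_volTwoPoint_box` (the limit along boxes exists and is the sup),
  `infTwoPoint_le_pow_nnBoxShellSum` (Lieb's box bound passes to infinite volume).
* `nnBoxShellSum_le_sum_sphere_infTwoPoint` — **Simon's form in infinite volume**:
  `S_R(K) ≤ ∑_{‖b‖_∞ = R} G_K(0, b)` (any `ν`, `R`).
* `exists_nnBoxShellSum_lt_one_of_summable` — **finite susceptibility terminates Lieb's algorithm**: if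
  `χ(K) = ∑_x G_K(0, x) < ∞` (`Summable`) then `S_R(K) < 1` for some `R ≥ 1` (the sphere sums of a summable function
  tend to `0`); hence (`ν = 2`) **`tendsto_torusXYStiffness_of_summable_infTwoPoint`: `χ(K) < ∞ ⇒ βΥ_{L}(K) → 0`**
  — the torus helicity modulus vanishes in the thermodynamic limit throughout the phase of finite susceptibility —
  and `infTwoPoint_decay_of_summable`: **summable ⇒ exponentially decaying** (Simon–Lieb for rotators).
* `summable_infTwoPoint_of_nnBoxShellSum_lt_one`, `summable_infTwoPoint_iff` (`ν = 2`):
  `χ(K) < ∞ ⇔ ∃ R ≥ 1, S_R(K) < 1` — Lieb's finite algorithm terminates EXACTLY on the phase `χ < ∞` ("one can, in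
  principle, compute `β_c` to arbitrary accuracy", made precise), with `χ(K) ≤ X_R(S_R(K))`.
* `not_summable_infTwoPoint_of_not_tendsto_torusXYStiffness`, `one_le_sum_sphere_infTwoPoint_of_not_tendsto` —
  **read backwards: if the stiffness does not vanish (`βΥ_{L}(K) ↛ 0`) then `χ(K) = ∞`, indeed every sphere sum
  `∑_{‖b‖_∞ = R} G_K(0,b) ≥ 1`** (no decay faster than `1/(8R)` on spheres): the stiffness onset of the 2D XY model
  lies at or below the divergence of the susceptibility — the structural half of `T_Υ = T_χ (= T_KT)`.
* `summable_infTwoPoint_of_lt_log_one_add_sqrt_two` — `χ(K) < ∞` for every `0 ≤ K < log(1+√2)` (the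
  Aizenman–Simon–Onsager window of `PlaneRotatorOnsagerWindow.lean`).

* `nnBoxShellSum_one` — **the first step of the algorithm in every dimension is Theorem 4's star**:
  `S_1(K) = 2ν·I₁(K)/I₀(K)` (the `2ν` neighbours `±eᵢ` of the centre, `card_neighborFinset_zdGraph_holds`); hence on
  `ℤ²` the explicit susceptibility bound `χ(K) ≤ 1 + 32u(K)/(1 − 4u(K))²` throughout Lieb's phase `4u(K) < 1`
  (`tsum_infTwoPoint_le_of_four_mul_besselRatio_lt_one`).

Cell `pub/hubbard-tc` (MO-S3, crux №2 classical side): number-neutral structure theorems on the comparison model.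
WHAT THIS IS NOT: not `Υ_∞ > 0` at low temperature (Fröhlich–Spencer), not the jump, not a Hubbard statement.
-/

noncomputable section

open MeasureTheory Finset Filter Topology
open scoped BigOperators

namespace Literature.Probability.LatticeModels

namespace PlaneRotator

open Literature.Barriers.CriticalPhenomena Literature.Barriers.CriticalPhenomena.LongRangeIsing

variable [MeasurableSpace Circle] [BorelSpace Circle]

/-! ## §1 Finite-volume two-point functions between lattice sites; monotonicity in the volume -/

section Volume

variable {ν : ℕ}

/-- The **finite-volume two-point function between lattice sites**: `⟨cos(θ_x − θ_y)⟩_{Λ,K}` for the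
nearest-neighbour plane rotator on the finite `Λ ⊂ ℤ^ν` (free boundary conditions) if `x, y ∈ Λ`, and `0` otherwise.
[cite: Ginibre1970, Example 4 (plane rotators)] -/
def volTwoPoint (K : ℝ) (ν : ℕ) (Λ : Finset (Site ν)) (x y : Site ν) : ℝ :=
  if h : x ∈ Λ ∧ y ∈ Λ then twoPoint (nnXYCoupling K ν Λ) ⟨x, h.1⟩ ⟨y, h.2⟩ else 0

/-- Inside the volume, `volTwoPoint` is the two-point function. [cite: Ginibre1970, Example 4 (plane rotators)] -/
theorem volTwoPoint_of_mem (K : ℝ) {Λ : Finset (Site ν)} {x y : Site ν} (hx : x ∈ Λ) (hy : y ∈ Λ) :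
    volTwoPoint K ν Λ x y = twoPoint (nnXYCoupling K ν Λ) ⟨x, hx⟩ ⟨y, hy⟩ := by
  unfold volTwoPoint
  rw [dif_pos ⟨hx, hy⟩]

omit [MeasurableSpace Circle] [BorelSpace Circle] in
/-- The nearest-neighbour couplings are non-negative for `K ≥ 0`. [cite: Ginibre1970, Example 4 (plane rotators)] -/
private theorem nnXYCoupling_nonneg' {K : ℝ} (hK : 0 ≤ K) (Λ : Finset (Site ν)) (p : Λ × Λ) :
    0 ≤ nnXYCoupling K ν Λ p :=
  mul_nonneg (div_nonneg hK zero_le_two) (nnCoupling_nonneg _ _)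

/-- `0 ≤ volTwoPoint` for `K ≥ 0` (Griffiths' first inequality). [cite: Ginibre1970, Example 4 (plane rotators)] -/
theorem volTwoPoint_nonneg {K : ℝ} (hK : 0 ≤ K) (Λ : Finset (Site ν)) (x y : Site ν) :
    0 ≤ volTwoPoint K ν Λ x y := by
  unfold volTwoPoint
  split_ifs with h
  · exact twoPoint_nonneg (nnXYCoupling_nonneg' hK Λ) _ _
  · exact le_rfl

/-- `volTwoPoint ≤ 1`. [cite: Ginibre1970, Example 4 (plane rotators)] -/
theorem volTwoPoint_le_one (K : ℝ) (Λ : Finset (Site ν)) (x y : Site ν) : volTwoPoint K ν Λ x y ≤ 1 := by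
  unfold volTwoPoint
  split_ifs with h
  · exact twoPoint_le_one _ _ _
  · exact zero_le_one

/-- **Griffiths–Ginibre monotonicity in the volume**: `Λ ⊆ Λ'` ⇒ `⟨cos(θ_x − θ_y)⟩_{Λ,K} ≤ ⟨cos(θ_x − θ_y)⟩_{Λ',K}`
(`K ≥ 0`; adding the sites and bonds of `Λ' ∖ Λ` only adds ferromagnetic couplings).
[cite: Ginibre1970, Prop. 3 with Example 4 (plane rotators)] -/
theorem volTwoPoint_mono {K : ℝ} (hK : 0 ≤ K) {Λ Λ' : Finset (Site ν)} (hΛ : Λ ⊆ Λ') (x y : Site ν) :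
    volTwoPoint K ν Λ x y ≤ volTwoPoint K ν Λ' x y := by
  classical
  by_cases h : x ∈ Λ ∧ y ∈ Λ
  · rw [volTwoPoint_of_mem K h.1 h.2, volTwoPoint_of_mem K (hΛ h.1) (hΛ h.2)]
    let τ : Λ → Λ' := fun u => ⟨(u : Site ν), hΛ u.2⟩
    have hτ : Set.InjOn τ (Finset.univ : Finset Λ) := fun u _ v _ huv => by
      have h' : ((τ u : Λ') : Site ν) = (τ v : Λ') := congrArg Subtype.val huv
      exact Subtype.ext h'
    exact twoPoint_le_of_injOn (nnXYCoupling_nonneg' hK Λ) (A := Finset.univ)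
      (fun p _ => ⟨Finset.mem_univ _, Finset.mem_univ _⟩) τ hτ (nnXYCoupling_nonneg' hK Λ')
      (fun u _ v _ => le_rfl) (Finset.mem_univ _) (Finset.mem_univ _)
  · unfold volTwoPoint
    rw [dif_neg h]
    exact volTwoPoint_nonneg hK Λ' x y

omit [MeasurableSpace Circle] [BorelSpace Circle] in
/-- Every finite set of sites lies in a box. [folklore] -/
private theorem exists_subset_box' (Λ : Finset (Site ν)) : ∃ n : ℕ, Λ ⊆ box ν n := by
  classical
  refine ⟨Λ.sup Site.supNorm, fun x hx => mem_box_iff_supNorm_le.2 ?_⟩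
  exact Finset.le_sup (f := Site.supNorm) hx

end Volume

/-! ## §2 The infinite-volume two-point function -/

section Infinite

variable {ν : ℕ}

/-- The **infinite-volume (free-state) two-point function** of the nearest-neighbour plane rotator on `ℤ^ν`:
`G_K(x, y) = sup_n ⟨cos(θ_x − θ_y)⟩_{[−n,n]^ν, K}` — by Griffiths–Ginibre monotonicity in the volume this is the limit
along the boxes and the supremum over all finite volumes. [cite: Ginibre1970, Prop. 3 with Example 4 (plane rotators); Simon1980CMP, Thm 1.3 (infinite-volume two-point function)] -/
def infTwoPoint (K : ℝ) (ν : ℕ) (x y : Site ν) : ℝ := ⨆ n : ℕ, volTwoPoint K ν (box ν n) x y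

/-- The box two-point functions are bounded by `1`, so the supremum defining `infTwoPoint` is a genuine one.
[cite: Ginibre1970, Example 4 (plane rotators)] -/
theorem bddAbove_volTwoPoint_box (K : ℝ) (x y : Site ν) :
    BddAbove (Set.range fun n : ℕ => volTwoPoint K ν (box ν n) x y) :=
  ⟨1, by rintro _ ⟨n, rfl⟩; exact volTwoPoint_le_one K _ x y⟩

/-- Every box is dominated by the infinite volume. [cite: Ginibre1970, Prop. 3 with Example 4 (plane rotators)] -/
theorem volTwoPoint_box_le_infTwoPoint (K : ℝ) (n : ℕ) (x y : Site ν) :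
    volTwoPoint K ν (box ν n) x y ≤ infTwoPoint K ν x y :=
  le_ciSup (bddAbove_volTwoPoint_box K x y) n

/-- **Every finite volume is dominated by the infinite-volume two-point function** (`K ≥ 0`).
[cite: Ginibre1970, Prop. 3 with Example 4 (plane rotators)] -/
theorem volTwoPoint_le_infTwoPoint {K : ℝ} (hK : 0 ≤ K) (Λ : Finset (Site ν)) (x y : Site ν) :
    volTwoPoint K ν Λ x y ≤ infTwoPoint K ν x y := by
  obtain ⟨n, hn⟩ := exists_subset_box' Λ
  exact (volTwoPoint_mono hK hn x y).trans (volTwoPoint_box_le_infTwoPoint K n x y)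

/-- The finite-volume two-point function inside `Λ` is dominated by the infinite volume (subtype form).
[cite: Ginibre1970, Prop. 3 with Example 4 (plane rotators)] -/
theorem twoPoint_le_infTwoPoint {K : ℝ} (hK : 0 ≤ K) (Λ : Finset (Site ν)) (a b : Λ) :
    twoPoint (nnXYCoupling K ν Λ) a b ≤ infTwoPoint K ν (a : Site ν) (b : Site ν) := by
  have h := volTwoPoint_le_infTwoPoint hK Λ (a : Site ν) (b : Site ν)
  rwa [volTwoPoint_of_mem K a.2 b.2] at h

/-- `G_K ≤ 1` (`|⟨cos⟩| ≤ 1` in every volume). [cite: Ginibre1970, Example 4 (plane rotators)] -/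
theorem infTwoPoint_le_one (K : ℝ) (x y : Site ν) : infTwoPoint K ν x y ≤ 1 :=
  ciSup_le fun _ => volTwoPoint_le_one K _ x y

/-- `0 ≤ G_K` for `K ≥ 0`. [cite: Ginibre1970, Example 4 (plane rotators)] -/
theorem infTwoPoint_nonneg {K : ℝ} (hK : 0 ≤ K) (x y : Site ν) : 0 ≤ infTwoPoint K ν x y :=
  (volTwoPoint_nonneg hK (box ν 0) x y).trans (volTwoPoint_box_le_infTwoPoint K 0 x y)

/-- An upper bound valid in every box is an upper bound for `G_K` (the infinite-volume state is the limit of the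
box states). [cite: Simon1980CMP, Thm 1.3 (infinite-volume two-point function as the limit of finite volumes)] -/
theorem infTwoPoint_le_of_forall_box {K B : ℝ} {x y : Site ν} (h : ∀ n : ℕ, volTwoPoint K ν (box ν n) x y ≤ B) :
    infTwoPoint K ν x y ≤ B :=
  ciSup_le h

/-- **The thermodynamic limit along boxes exists and equals `G_K`** (monotone convergence, `K ≥ 0`).
[cite: Ginibre1970, Prop. 3 with Example 4 (plane rotators); Simon1980CMP, Thm 1.3] -/
theorem tendsto_volTwoPoint_box {K : ℝ} (hK : 0 ≤ K) (x y : Site ν) :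
    Tendsto (fun n : ℕ => volTwoPoint K ν (box ν n) x y) atTop (𝓝 (infTwoPoint K ν x y)) :=
  tendsto_atTop_ciSup (fun _ _ hnm => volTwoPoint_mono hK (box_mono ν hnm) x y) (bddAbove_volTwoPoint_box K x y)

/-- **Lieb's box bound in infinite volume**: `G_K(x, y) ≤ S_R(K)^{⌊‖x − y‖_∞/R⌋}` for `K ≥ 0`, `R ≥ 1`
(`twoPoint_nn_le_pow_boxShellSum` in every box). [cite: Lieb1980, eq. (23) and p. 128 (boxes; finite algorithm)] -/
theorem infTwoPoint_le_pow_nnBoxShellSum {K : ℝ} (hK : 0 ≤ K) {R : ℕ} (hR : 1 ≤ R) (x y : Site ν) :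
    infTwoPoint K ν x y ≤ nnBoxShellSum K ν R ^ (Site.supNorm (x - y) / R) := by
  refine infTwoPoint_le_of_forall_box fun n => ?_
  by_cases h : x ∈ box ν n ∧ y ∈ box ν n
  · rw [volTwoPoint_of_mem K h.1 h.2]
    exact twoPoint_nn_le_pow_boxShellSum hK hR (box ν n) ⟨x, h.1⟩ ⟨y, h.2⟩
  · unfold volTwoPoint
    rw [dif_neg h]
    exact pow_nonneg (boxShellSum_nonneg (fun u v => mul_nonneg (by positivity) (nnCoupling_nonneg _ _)) R) _

end Infinite

/-! ## §3 Simon's form in infinite volume; finite susceptibility terminates Lieb's algorithm -/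

section Simon

variable {ν : ℕ}

/-- **Simon's form of the box number in infinite volume**: `S_R(K) ≤ ∑_{‖b‖_∞ = R} G_K(0, b)` (`K ≥ 0`; the box
number is the shell sum of the reference box `[−R,R]^ν` with the shell bonds removed, at most the shell sum of the free
box, at most the infinite volume). [cite: Simon1980CMP, Thm 1.3; Lieb1980, eq. (23) and notes added in proof] -/
theorem nnBoxShellSum_le_sum_sphere_infTwoPoint {K : ℝ} (hK : 0 ≤ K) (R : ℕ) :
    nnBoxShellSum K ν R ≤ ∑ b ∈ sphere ν R, infTwoPoint K ν 0 b := by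
  classical
  have h0 : (0 : Site ν) ∈ box ν R := zero_mem_box ν R
  refine (nnBoxShellSum_le_sum_shell_twoPoint hK (box ν R) subset_rfl).trans ?_
  -- the shell sum over the subtype is the sphere sum of `volTwoPoint`
  have e1 : (∑ b ∈ Finset.univ.filter (fun b : box ν R => Site.supNorm (b : Site ν) = R),
        PlaneRotator.twoPoint (nnXYCoupling K ν (box ν R)) ⟨0, h0⟩ b) =
      ∑ b ∈ sphere ν R, volTwoPoint K ν (box ν R) 0 b := by
    rw [Finset.sum_filter, sphere, Finset.sum_filter,
      ← Finset.sum_coe_sort (box ν R) (fun b : Site ν =>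
        if Site.supNorm b = R then volTwoPoint K ν (box ν R) 0 b else 0)]
    refine Finset.sum_congr rfl fun b _ => ?_
    split_ifs with hb
    · rw [volTwoPoint_of_mem K h0 b.2]
    · rfl
  rw [e1]
  exact Finset.sum_le_sum fun b _ => volTwoPoint_box_le_infTwoPoint K R 0 b

omit [MeasurableSpace Circle] [BorelSpace Circle] in
/-- The sphere sums of a summable function on `ℤ^ν` tend to `0` (partial sums over the boxes converge; consecutive
differences are the sphere sums). [folklore] -/
private theorem tendsto_sum_sphere_of_summable {G : Site ν → ℝ} (hG0 : ∀ x, 0 ≤ G x) (hG : Summable G) :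
    Tendsto (fun R : ℕ => ∑ b ∈ sphere ν R, G b) atTop (𝓝 0) := by
  classical
  -- partial sums over boxes: monotone and bounded by the total sum, hence convergent
  set P : ℕ → ℝ := fun n => ∑ b ∈ box ν n, G b with hP
  have hPmono : Monotone P := fun n m hnm =>
    Finset.sum_le_sum_of_subset_of_nonneg (box_mono ν hnm) fun b _ _ => hG0 b
  have hPbdd : BddAbove (Set.range P) :=
    ⟨∑' b, G b, by rintro _ ⟨n, rfl⟩; exact hG.sum_le_tsum _ (fun b _ => hG0 b)⟩
  have hPlim : Tendsto P atTop (𝓝 (⨆ n, P n)) := tendsto_atTop_ciSup hPmono hPbdd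
  -- sphere (n+1) = box (n+1) \ box n, so its sum is `P (n+1) − P n → 0`
  have hdiff : Tendsto (fun n : ℕ => P (n + 1) - P n) atTop (𝓝 0) := by
    have h := (hPlim.comp (tendsto_add_atTop_nat 1)).sub hPlim
    rw [sub_self] at h
    exact h
  have heq : ∀ n : ℕ, ∑ b ∈ sphere ν (n + 1), G b = P (n + 1) - P n := by
    intro n
    rw [sphere_succ_eq_sdiff, Finset.sum_sdiff_eq_sub (box_mono ν (Nat.le_succ n))]
  rw [← tendsto_add_atTop_iff_nat 1]
  simp_rw [heq]
  exact hdiff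

/-- **Finite susceptibility terminates Lieb's finite algorithm.** If the infinite-volume two-point function is
summable, `χ(K) = ∑_{x ∈ ℤ^ν} G_K(0, x) < ∞` (`K ≥ 0`), then `S_R(K) < 1` for some box radius `R ≥ 1` — so
(`twoPoint_nn_le_pow_boxShellSum`) the two-point function decays exponentially, uniformly in every finite volume:
Simon's "summable ⇒ exponential" for plane rotators, via Lieb–Rivasseau.
[cite: Simon1980CMP, Thm 1.3 (Σ⟨σ₀σ_x⟩ < ∞ ⇒ exponential decay); Lieb1980, p. 128 (φ(β) < 1 for a box)] -/
theorem exists_nnBoxShellSum_lt_one_of_summable {K : ℝ} (hK : 0 ≤ K)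
    (hG : Summable fun x : Site ν => infTwoPoint K ν 0 x) :
    ∃ R : ℕ, 1 ≤ R ∧ nnBoxShellSum K ν R < 1 := by
  have hlim := tendsto_sum_sphere_of_summable (fun x => infTwoPoint_nonneg hK 0 x) hG
  have hev : ∀ᶠ R : ℕ in atTop, ∑ b ∈ sphere ν R, infTwoPoint K ν 0 b < 1 :=
    hlim.eventually (gt_mem_nhds one_pos)
  obtain ⟨R, hR1, hRlt⟩ := ((eventually_ge_atTop 1).and hev).exists
  exact ⟨R, hR1, (nnBoxShellSum_le_sum_sphere_infTwoPoint hK R).trans_lt hRlt⟩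

/-- **Summable ⇒ exponentially decaying** (Simon–Lieb for the plane rotator on `ℤ^ν`): if `χ(K) < ∞` then there
are `R ≥ 1` and `0 ≤ m < 1` with `G_K(x, y) ≤ m^{⌊‖x − y‖_∞/R⌋}` for all `x, y` (`m = S_R(K)`).
[cite: Simon1980CMP, Thm 1.3; Lieb1980, Theorem 4 and p. 128] -/
theorem infTwoPoint_decay_of_summable {K : ℝ} (hK : 0 ≤ K)
    (hG : Summable fun x : Site ν => infTwoPoint K ν 0 x) :
    ∃ R : ℕ, 1 ≤ R ∧ ∃ m : ℝ, 0 ≤ m ∧ m < 1 ∧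
      ∀ x y : Site ν, infTwoPoint K ν x y ≤ m ^ (Site.supNorm (x - y) / R) := by
  obtain ⟨R, hR, hS⟩ := exists_nnBoxShellSum_lt_one_of_summable hK hG
  exact ⟨R, hR, nnBoxShellSum K ν R,
    boxShellSum_nonneg (fun u v => mul_nonneg (by positivity) (nnCoupling_nonneg _ _)) R, hS,
    fun x y => infTwoPoint_le_pow_nnBoxShellSum hK hR x y⟩

end Simon

/-! ## §4 The square lattice: `χ(K) < ∞ ⇔ ∃R, S_R(K) < 1`, and the helicity modulus -/

section Square

/-- **A terminating box certifies a finite susceptibility** (`ν = 2`): if `S_R(K) < 1` for some `R ≥ 1` then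
`G_K(0, ·)` is summable and `χ(K) = ∑_x G_K(0, x) ≤ X_R(S_R(K))` (`boxSusceptibilityBound`: Lieb's bound summed over
the lattice, `sum_pow_supNorm_div_le`). [cite: Lieb1980, p. 128 (φ(β) < 1 ⇒ exponential decay); Simon1980CMP, Thm 1.3] -/
theorem summable_infTwoPoint_of_nnBoxShellSum_lt_one {K : ℝ} (hK : 0 ≤ K) {R : ℕ} (hR : 1 ≤ R)
    (hS : nnBoxShellSum K 2 R < 1) :
    Summable (fun x : Site 2 => infTwoPoint K 2 0 x) ∧
      ∑' x : Site 2, infTwoPoint K 2 0 x ≤ boxSusceptibilityBound R (nnBoxShellSum K 2 R) := by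
  have hS0 : 0 ≤ nnBoxShellSum K 2 R :=
    boxShellSum_nonneg (fun u v => mul_nonneg (by positivity) (nnCoupling_nonneg _ _)) R
  have hbound : ∀ s : Finset (Site 2), ∑ x ∈ s, infTwoPoint K 2 0 x ≤
      boxSusceptibilityBound R (nnBoxShellSum K 2 R) := by
    intro s
    calc ∑ x ∈ s, infTwoPoint K 2 0 x
        ≤ ∑ x ∈ s, nnBoxShellSum K 2 R ^ (Site.supNorm (x - 0) / R) :=
          Finset.sum_le_sum fun x _ => by
            have h := infTwoPoint_le_pow_nnBoxShellSum (ν := 2) hK hR 0 x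
            rwa [← neg_sub, Site.supNorm_neg] at h
      _ ≤ boxSusceptibilityBound R (nnBoxShellSum K 2 R) := sum_pow_supNorm_div_le hR hS0 hS s 0
  have hsum : Summable (fun x : Site 2 => infTwoPoint K 2 0 x) :=
    summable_of_sum_le (fun x => infTwoPoint_nonneg hK 0 x) hbound
  exact ⟨hsum, hsum.tsum_le_of_sum_le hbound⟩

/-- **Lieb's finite algorithm terminates exactly on the phase of finite susceptibility** (`ν = 2`, `K ≥ 0`):
`∑_x G_K(0, x) < ∞ ⇔ ∃ R ≥ 1, S_R(K) < 1`. [cite: Lieb1980, p. 128 (boxes: "one can, in principle, compute β_c to arbitrary accuracy"); Simon1980CMP, Thm 1.3] -/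
theorem summable_infTwoPoint_iff {K : ℝ} (hK : 0 ≤ K) :
    Summable (fun x : Site 2 => infTwoPoint K 2 0 x) ↔ ∃ R : ℕ, 1 ≤ R ∧ nnBoxShellSum K 2 R < 1 :=
  ⟨exists_nnBoxShellSum_lt_one_of_summable hK,
    fun ⟨_, hR, hS⟩ => (summable_infTwoPoint_of_nnBoxShellSum_lt_one hK hR hS).1⟩

/-- **Finite susceptibility kills the stiffness**: if `χ(K) = ∑_x G_K(0, x) < ∞` (`K ≥ 0`) then the torus helicity
modulus vanishes in the thermodynamic limit, `βΥ_{L}(K) → 0` (`torusXYStiffness (L+1) K → 0`) — Simon's form plus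
the box criterion for the stiffness (`tendsto_torusXYStiffness_of_nnBoxShellSum_lt_one`). So the stiffness onset of
the two-dimensional XY model lies at or below the divergence of the susceptibility.
[cite: Simon1980CMP, Thm 1.3; Lieb1980, p. 128 (boxes)] -/
theorem tendsto_torusXYStiffness_of_summable_infTwoPoint {K : ℝ} (hK : 0 ≤ K)
    (hG : Summable fun x : Site 2 => infTwoPoint K 2 0 x) :
    Tendsto (fun L : ℕ => torusXYStiffness (L + 1) K) atTop (𝓝 0) := by
  obtain ⟨R, hR, hS⟩ := exists_nnBoxShellSum_lt_one_of_summable hK hG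
  exact tendsto_torusXYStiffness_of_nnBoxShellSum_lt_one hR hK hS

/-- **Read backwards — a non-vanishing stiffness forces an infinite susceptibility**: if `βΥ_{L}(K) ↛ 0` (`K ≥ 0`)
then `G_K(0, ·)` is NOT summable, `χ(K) = ∞`. [cite: Simon1980CMP, Thm 1.3; Lieb1980, p. 128 (boxes)] -/
theorem not_summable_infTwoPoint_of_not_tendsto_torusXYStiffness {K : ℝ} (hK : 0 ≤ K)
    (hnot : ¬ Tendsto (fun L : ℕ => torusXYStiffness (L + 1) K) atTop (𝓝 0)) :
    ¬ Summable fun x : Site 2 => infTwoPoint K 2 0 x :=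
  fun hG => hnot (tendsto_torusXYStiffness_of_summable_infTwoPoint hK hG)

/-- **Sphere by sphere**: if `βΥ_{L}(K) ↛ 0` then EVERY sphere sum of the infinite-volume two-point function is at
least one, `∑_{‖b‖_∞ = R} G_K(0, b) ≥ 1` for all `R ≥ 1` — on average no decay faster than `1/(8R)` along the
spheres of `ℤ²`. [cite: Simon1980CMP, Thm 1.3; Lieb1980, p. 128 (boxes)] -/
theorem one_le_sum_sphere_infTwoPoint_of_not_tendsto {K : ℝ} (hK : 0 ≤ K)
    (hnot : ¬ Tendsto (fun L : ℕ => torusXYStiffness (L + 1) K) atTop (𝓝 0)) {R : ℕ} (hR : 1 ≤ R) :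
    1 ≤ ∑ b ∈ sphere 2 R, infTwoPoint K 2 0 b :=
  (one_le_nnBoxShellSum_of_not_tendsto_torusXYStiffness hK hnot hR).trans
    (nnBoxShellSum_le_sum_sphere_infTwoPoint hK R)

/-- **The susceptibility of the two-dimensional XY model is finite throughout the Aizenman–Simon–Onsager window**:
for `0 ≤ K < log(1+√2)`, `G_K(0, ·)` is summable on `ℤ²` (a terminating box exists there,
`exists_nnBoxShellSum_lt_one_of_lt_log_one_add_sqrt_two`). [cite: AizenmanSimon1980RotorIsing, eqs. (1)–(2); Lieb1980, p. 128] -/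
theorem summable_infTwoPoint_of_lt_log_one_add_sqrt_two {K : ℝ} (hK0 : 0 ≤ K)
    (hK : K < Real.log (1 + Real.sqrt 2)) :
    Summable fun x : Site 2 => infTwoPoint K 2 0 x := by
  obtain ⟨R, hR, hS⟩ := exists_nnBoxShellSum_lt_one_of_lt_log_one_add_sqrt_two hK0 hK
  exact (summable_infTwoPoint_of_nnBoxShellSum_lt_one hK0 hR hS).1

end Square

/-! ## §5 The first step of the finite algorithm in every dimension: `S_1(K) = 2ν·I₁(K)/I₀(K)` -/

section RadiusOne

variable {ν : ℕ}

omit [MeasurableSpace Circle] [BorelSpace Circle] in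
/-- The symmetrised nearest-neighbour coupling seen from the origin: `(K/2)𝟙{0∼y} + (K/2)𝟙{y∼0} = K·𝟙{‖y‖₁ = 1}`.
[folklore] -/
private theorem nn_origin_symm' (K : ℝ) (y : Site ν) :
    K / 2 * nnCoupling ν 0 y + K / 2 * nnCoupling ν y 0 = if l1Norm y = 1 then K else 0 := by
  unfold nnCoupling
  rw [zero_sub, l1Norm_neg, sub_zero]
  split_ifs <;> ring

omit [MeasurableSpace Circle] [BorelSpace Circle] in
/-- `‖y‖_∞ ≤ ‖y‖₁`. [folklore] -/
private theorem supNorm_le_l1Norm' (y : Site ν) : Site.supNorm y ≤ l1Norm y :=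
  Site.supNorm_le_iff.2 fun i =>
    Finset.single_le_sum (f := fun i => (y i).natAbs) (fun _ _ => Nat.zero_le _) (Finset.mem_univ i)

omit [MeasurableSpace Circle] [BorelSpace Circle] in
/-- The shell sites of `[−1,1]^ν` at `ℓ¹`-distance one from the centre are the `2ν` neighbours `±eᵢ` of the origin
(tree `card_neighborFinset_zdGraph_holds`). [folklore] -/
private theorem card_refShell_one_filter_l1Norm :
    #((refShell ν 1).filter fun b : box ν 1 => l1Norm (b : Site ν) = 1) = 2 * ν := by
  classical
  have hmap : ((refShell ν 1).filter fun b : box ν 1 => l1Norm (b : Site ν) = 1).map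
      (Function.Embedding.subtype _) = (zdGraph ν).neighborFinset 0 := by
    ext y
    simp only [refShell, Finset.mem_map, Finset.mem_filter, Finset.mem_univ, true_and,
      Function.Embedding.coe_subtype, SimpleGraph.mem_neighborFinset]
    constructor
    · rintro ⟨b, ⟨_, hb2⟩, rfl⟩
      exact adj_of_l1Norm_sub_eq_one (by rw [zero_sub, l1Norm_neg]; exact hb2)
    · intro hy
      have h1 : l1Norm y = 1 := by
        have h := l1Norm_sub_eq_one_of_adj hy
        rwa [zero_sub, l1Norm_neg] at h
      have hsup : Site.supNorm y = 1 := by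
        have hle : Site.supNorm y ≤ 1 := (supNorm_le_l1Norm' y).trans h1.le
        have hne : Site.supNorm y ≠ 0 := fun h0 => by
          have hy0 : y = 0 := Site.supNorm_eq_zero_iff.1 h0
          subst hy0
          simp [l1Norm] at h1
        omega
      exact ⟨⟨y, mem_box_iff_supNorm_le.2 hsup.le⟩, ⟨hsup, h1⟩, rfl⟩
  rw [← Finset.card_map, hmap]
  exact card_neighborFinset_zdGraph_holds 0

/-- **Lieb's number at `R = 1` is Theorem 4's star value in every dimension**:
`S_1(K) = nnBoxShellSum K ν 1 = 2ν · I₁(K)/I₀(K)` (tree `boxShellSum_one`: the `2ν` neighbours of the centre contribute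
the two-spin value `I₁(K)/I₀(K)` each, the other shell sites of `[−1,1]^ν` are free rotators, `I₁(0)/I₀(0) = 0`). So the
first step of the finite algorithm (`twoPoint_nn_le_pow_boxShellSum`, and on `ℤ²`
`tendsto_torusXYStiffness_of_nnBoxShellSum_lt_one`) is `2ν·u(K) < 1`: `β_c ≥ 0.52` (`ν = 2`), `≥ 0.34` (`ν = 3`).
[cite: Lieb1980, Theorem 4 (2ν I₁(β)/I₀(β) < 1; β_c ≥ 0.52 for ν = 2, ≥ 0.34 for ν = 3)] -/
theorem nnBoxShellSum_one (K : ℝ) : nnBoxShellSum K ν 1 = 2 * ν * (besselI 1 K / besselI 0 K) := by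
  classical
  unfold nnBoxShellSum
  rw [boxShellSum_one]
  have e1 : ∀ b ∈ refShell ν 1,
      besselI 1 (K / 2 * nnCoupling ν 0 (b : Site ν) + K / 2 * nnCoupling ν (b : Site ν) 0) /
        besselI 0 (K / 2 * nnCoupling ν 0 (b : Site ν) + K / 2 * nnCoupling ν (b : Site ν) 0) =
      if l1Norm (b : Site ν) = 1 then besselI 1 K / besselI 0 K else 0 := by
    intro b _
    rw [nn_origin_symm']
    split_ifs
    · rfl
    · simp [besselI_zero_right]
  rw [Finset.sum_congr rfl e1, ← Finset.sum_filter, Finset.sum_const, card_refShell_one_filter_l1Norm, nsmul_eq_mul]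
  push_cast
  ring

/-- **An explicit susceptibility bound throughout Lieb's phase on `ℤ²`**: if `4u(K) < 1` (`u = I₁/I₀`, `K ≥ 0`) then
`G_K(0,·)` is summable and `χ(K) = ∑_x G_K(0, x) ≤ X_1(4u(K)) = 1 + 32u(K)/(1 − 4u(K))²` (`boxSusceptibilityBound` at
`R = 1`). [cite: Lieb1980, Theorem 4 (β_c ≥ 0.52 for ν = 2); Simon1980CMP, Thm 1.3] -/
theorem tsum_infTwoPoint_le_of_four_mul_besselRatio_lt_one {K : ℝ} (hK : 0 ≤ K)
    (h : 4 * (besselI 1 K / besselI 0 K) < 1) :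
    Summable (fun x : Site 2 => infTwoPoint K 2 0 x) ∧
      ∑' x : Site 2, infTwoPoint K 2 0 x ≤
        1 + 32 * (besselI 1 K / besselI 0 K) / (1 - 4 * (besselI 1 K / besselI 0 K)) ^ 2 := by
  have e : nnBoxShellSum K 2 1 = 4 * (besselI 1 K / besselI 0 K) := by
    rw [nnBoxShellSum_one]; push_cast; ring
  have hS : nnBoxShellSum K 2 1 < 1 := by rw [e]; exact h
  obtain ⟨hsum, hle⟩ := summable_infTwoPoint_of_nnBoxShellSum_lt_one hK le_rfl hS
  refine ⟨hsum, hle.trans (le_of_eq ?_)⟩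
  rw [e]
  unfold boxSusceptibilityBound
  push_cast
  ring

end RadiusOne

end PlaneRotator

end Literature.Probability.LatticeModels

end
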